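import Mathlib.RingTheory.LaurentSeries
import Mathlib.RingTheory.PowerSeries.Inverse
import Literature.NumberTheory.Transcendental.LaurentEulerOperator
import HarnessLib

/-!
# The invariant differential of `y² = x³ + Ax + B` along `t·d/dt` vanishes at `t = 0`

Topic `Literature/NumberTheory/Transcendental`. Second support file for discharging the named
fact `Literature.NumberTheory.Transcendental.ax_schanuel_weierstrass` (`AxSchanuelWeierstrass.lean`;
J. Kirby, Selecta Math. 15 (2009), Thm. 3.8 for `S = Eⁿ`). Everything here is PROVED; it is the
local computation replacing, for elliptic curves, the residue formula `CT(θu/u) = ord u` of the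
multiplicative case (`LaurentEulerOperator.lean`, used for Rosenlicht 1976 Prop. 4 and Ax 1971
Thm. 3 in `RosenlichtProp4Residues.lean`).

**Statement** (`coeff_eulerDerivation_div_eq_zero`). Let `K` be a field of characteristic zero,
`A, B ∈ K` with `4A³ + 27B² ≠ 0`, and let `g, h ∈ K⸨t⸩`, `h ≠ 0`, satisfy `h² = g³ + Ag + B`.
Then the Laurent series `θg/(2h)`, `θ = t·d/dt` the Euler derivation, has no terms of degree
`≤ 0`. In words: the pull-back `g*(dx/2y) = dg/(2h)` of the invariant differential of
`E : y² = x³ + Ax + B` along the `K⸨t⸩`-point `(g, h)` is a differential WITHOUT POLE at `t = 0`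
(a differential of the first kind pulls back to a regular differential), so that pairing it with
the vector field `t·d/dt`, which vanishes at `t = 0`, gives a function vanishing at `t = 0`.

**Proof** (folklore; e.g. Silverman, AEC IV.1 for the expansion at `O`). Three cases.
(i) `g` has a pole: comparing orders in `h² = g³ + Ag + B` gives `ord g = -2m`, `ord h = -3m`
with `m ≥ 1`, and `ord θg ≥ ord g`, so `ord(θg/2h) ≥ -2m + 3m = m ≥ 1`
(`coeff_eulerDerivation_div_of_order_neg`). Otherwise `g = G` and `h = H` are power series.
(ii) `H(0) ≠ 0`: `θG/(2H)` is the power series `θG · (2H)⁻¹`, whose constant term is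
`0 · G(0)/(2H(0)) = 0`. (iii) `H(0) = 0`: then `x₀ = G(0)` is a root of `x³ + Ax + B`, hence not
of `3x² + A` (the resultant is `4A³ + 27B² ≠ 0`, `disc_eq_zero_of_common_root`), so
`S = 3G² + A` is a unit; differentiating the equation, `2H·θH = S·θG`, so
`θG/(2H) = θH/S = θH · S⁻¹`, again a power series with zero constant term
(`coeff_eulerDerivation_div_coe`).

## References

* J. H. Silverman, *The Arithmetic of Elliptic Curves*, III.1.5 and IV.1 (the invariant
  differential is regular and non-vanishing; local expansions).
* J. Kirby, Selecta Math. (N.S.) 15 (2009), 445–486, §3 (the role of `ζ(y)(D)`).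
-/

noncomputable section

open HahnSeries
open scoped LaurentSeries PowerSeries

namespace Literature.NumberTheory.Transcendental

namespace AxSchanuelWeierstrass

open LaurentEuler

variable {K : Type*} [Field K]

/-- The order of the inverse of a non-zero Laurent series. [folklore] -/
theorem order_inv {f : K⸨X⸩} (hf : f ≠ 0) : f⁻¹.order = -f.order := by
  have h := HahnSeries.order_mul hf (inv_ne_zero hf)
  rw [mul_inv_cancel₀ hf, HahnSeries.order_one] at h
  omega

/-- `θ = t·d/dt` does not lower the order: `ord θf ≥ ord f` (when `θ f ≠ 0`). [folklore] -/
theorem order_le_order_eulerDerivation {f : K⸨X⸩} (hf : eulerDerivation K f ≠ 0) :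
    f.order ≤ (eulerDerivation K f).order := by
  have hf0 : f ≠ 0 := fun h => hf (by rw [h, map_zero])
  rw [HahnSeries.le_order_iff_forall hf]
  intro j hj
  rw [coeff_eulerDerivation, HahnSeries.coeff_eq_zero_of_lt_order hj, mul_zero]

/-- At a pole of `g` of order `-n > 0`, `g³ + Ag + B` has a pole of order exactly `-3n`.
[folklore] -/
theorem order_cubic_of_order_neg (A B : K) {g : K⸨X⸩} (hg : g ≠ 0) (hn : g.order < 0) :
    g ^ 3 + HahnSeries.C A * g + HahnSeries.C B ≠ 0 ∧
      (g ^ 3 + HahnSeries.C A * g + HahnSeries.C B).order = 3 * g.order := by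
  set n := g.order with hn_def
  have h3 : (g ^ 3).order = 3 * n := by rw [HahnSeries.order_pow, nsmul_eq_mul, Nat.cast_ofNat]
  have hg3 : g ^ 3 ≠ 0 := pow_ne_zero 3 hg
  -- the lower-order terms vanish in degrees `≤ 3n < n`
  have hs : ∀ j, j ≤ 3 * n → (HahnSeries.C A * g + HahnSeries.C B).coeff j = 0 := by
    intro j hj
    have hjn : j < n := by omega
    have hj0 : j ≠ 0 := by omega
    rw [HahnSeries.coeff_add, HahnSeries.C_mul_eq_smul, HahnSeries.coeff_smul,
      HahnSeries.coeff_eq_zero_of_lt_order hjn, smul_zero, zero_add, HahnSeries.C_apply,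
      HahnSeries.coeff_single_of_ne hj0]
  have hlead : (g ^ 3 + HahnSeries.C A * g + HahnSeries.C B).coeff (3 * n) ≠ 0 := by
    rw [add_assoc, HahnSeries.coeff_add, hs _ le_rfl, add_zero, ← h3]
    exact HahnSeries.coeff_order_eq_zero.not.mpr hg3
  have hne : g ^ 3 + HahnSeries.C A * g + HahnSeries.C B ≠ 0 := fun h => hlead (by rw [h]; rfl)
  refine ⟨hne, le_antisymm (HahnSeries.order_le_of_coeff_ne_zero hlead) ?_⟩
  rw [HahnSeries.le_order_iff_forall hne]
  intro j hj
  rw [add_assoc, HahnSeries.coeff_add, hs _ hj.le, add_zero]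
  exact HahnSeries.coeff_eq_zero_of_lt_order (by rw [h3]; exact hj)

/-- **Pole case.** If `h ≠ 0`, `h² = g³ + Ag + B` and `g` has a pole, then `g` has a pole of
even order `2m`, `h` one of order `3m`, and `θg/(2h)` has a zero: all its coefficients of index
`≤ 0` vanish. [folklore] -/
theorem coeff_eulerDerivation_div_of_order_neg [CharZero K] (A B : K) {g h : K⸨X⸩} (hh : h ≠ 0)
    (heq : h ^ 2 = g ^ 3 + HahnSeries.C A * g + HahnSeries.C B) (hn : g.order < 0) {j : ℤ}
    (hj : j ≤ 0) : (eulerDerivation K g / (2 * h)).coeff j = 0 := by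
  have hg : g ≠ 0 := by rintro rfl; simp at hn
  obtain ⟨-, hord⟩ := order_cubic_of_order_neg A B hg hn
  rw [← heq, HahnSeries.order_pow, nsmul_eq_mul, Nat.cast_ofNat] at hord
  -- `2 ord h = 3 ord g`
  by_cases hE : eulerDerivation K g = 0
  · rw [hE, zero_div]; rfl
  have hC2 : (2 : K⸨X⸩) = HahnSeries.C (2 : K) := (map_ofNat (HahnSeries.C : K →+* K⸨X⸩) 2).symm
  have h2 : (2 : K⸨X⸩) ≠ 0 := by rw [hC2]; exact HahnSeries.C_ne_zero two_ne_zero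
  have h2h : (2 : K⸨X⸩) * h ≠ 0 := mul_ne_zero h2 hh
  have hq : eulerDerivation K g / (2 * h) ≠ 0 := div_ne_zero hE h2h
  apply HahnSeries.coeff_eq_zero_of_lt_order
  rw [div_eq_mul_inv, HahnSeries.order_mul hE (inv_ne_zero h2h), order_inv h2h,
    HahnSeries.order_mul h2 hh, hC2, HahnSeries.order_C]
  have := order_le_order_eulerDerivation hE
  omega

/-! ### The regular case: `g`, `h` are power series -/

/-- A Laurent series of non-negative order is a power series. [folklore] -/
theorem exists_powerSeries_of_order_nonneg {f : K⸨X⸩} (hf : 0 ≤ f.order) :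
    ∃ F : K⟦X⟧, (F : K⸨X⸩) = f := by
  rw [← LaurentSeries.val_le_one_iff_eq_coe]
  have h := (LaurentSeries.valuation_le_iff_coeff_lt_eq_zero K (D := 0) (f := f)).mpr
    fun n hn => HahnSeries.coeff_eq_zero_of_lt_order (lt_of_lt_of_le hn hf)
  simpa using h

/-- If `h² ` is a power series then so is `h`. [folklore] -/
theorem exists_powerSeries_of_sq_eq_coe {h : K⸨X⸩} {P : K⟦X⟧} (heq : h ^ 2 = (P : K⸨X⸩)) :
    ∃ H : K⟦X⟧, (H : K⸨X⸩) = h := by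
  apply exists_powerSeries_of_order_nonneg
  by_contra hneg
  push Not at hneg
  have hh : h ≠ 0 := by rintro rfl; simp at hneg
  have h2 : (h ^ 2).order = 2 * h.order := by
    rw [HahnSeries.order_pow, nsmul_eq_mul, Nat.cast_ofNat]
  have hlead := HahnSeries.coeff_order_eq_zero.not.mpr (pow_ne_zero 2 hh)
  rw [h2, heq, PowerSeries.coeff_coe, if_pos (by omega)] at hlead
  exact hlead rfl

/-- A power series with zero constant term, viewed as a Laurent series, has no coefficients in
degrees `≤ 0`. [folklore] -/
theorem coeff_coe_eq_zero_of_constantCoeff {T : K⟦X⟧} (hT : PowerSeries.constantCoeff T = 0)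
    {j : ℤ} (hj : j ≤ 0) : (T : K⸨X⸩).coeff j = 0 := by
  rw [PowerSeries.coeff_coe]
  split_ifs with h
  · rfl
  · obtain rfl : j = 0 := le_antisymm hj (not_lt.mp h)
    simpa using hT

/-- `θ q` for a power series `q` is the power series `Σ n qₙ tⁿ`, which has zero constant term.
[folklore] -/
@[simp] theorem constantCoeff_eulerPS (q : K⟦X⟧) :
    PowerSeries.constantCoeff (PowerSeries.mk fun n => (n : K) * PowerSeries.coeff n q) = 0 := by
  rw [← PowerSeries.coeff_zero_eq_constantCoeff_apply, PowerSeries.coeff_mk]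
  simp

/-- The numeral `2` of `K⸨X⸩` is the constant series. [folklore] -/
theorem two_eq_C : (2 : K⸨X⸩) = HahnSeries.C (2 : K) :=
  (map_ofNat (HahnSeries.C : K →+* K⸨X⸩) 2).symm

/-- The numeral `3` of `K⸨X⸩` is the constant series. [folklore] -/
theorem three_eq_C : (3 : K⸨X⸩) = HahnSeries.C (3 : K) :=
  (map_ofNat (HahnSeries.C : K →+* K⸨X⸩) 3).symm

/-- If `x₀` is a common root of `x³ + Ax + B` and `3x² + A` then `4A³ + 27B² = 0` (the
resultant, over any commutative ring). [folklore] -/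
theorem disc_eq_zero_of_common_root {R : Type*} [CommRing R] {A B x₀ : R}
    (h1 : x₀ ^ 3 + A * x₀ + B = 0) (h2 : 3 * x₀ ^ 2 + A = 0) : 4 * A ^ 3 + 27 * B ^ 2 = 0 := by
  linear_combination (-18 * A * x₀ + 27 * B) * h1 + (6 * A * x₀ ^ 2 - 9 * B * x₀ + 4 * A ^ 2) * h2

/-- **Regular case.** If `G, H ≠ 0` are power series with `H² = G³ + AG + B` and
`4A³ + 27B² ≠ 0`, then `θG/(2H)` (computed in Laurent series) has no coefficients in degrees
`≤ 0`: if `H(0) ≠ 0` it is the power series `θG · (2H)⁻¹` with constant term `0`; if `H(0) = 0`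
then `3G(0)² + A ≠ 0` and `θG/(2H) = θH/(3G² + A)` is again such a power series. [folklore] -/
theorem coeff_eulerDerivation_div_coe [CharZero K] {A B : K} (hAB : 4 * A ^ 3 + 27 * B ^ 2 ≠ 0)
    {G H : K⟦X⟧} (hH : (H : K⸨X⸩) ≠ 0)
    (heq : (H : K⸨X⸩) ^ 2 = (G : K⸨X⸩) ^ 3 + HahnSeries.C A * (G : K⸨X⸩) + HahnSeries.C B) {j : ℤ}
    (hj : j ≤ 0) : (eulerDerivation K (G : K⸨X⸩) / (2 * H)).coeff j = 0 := by
  have h2 : (2 : K) ≠ 0 := two_ne_zero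
  by_cases hH0 : PowerSeries.constantCoeff H ≠ 0
  · -- `H` is a unit
    have hc : PowerSeries.constantCoeff (PowerSeries.C (2 : K) * H) ≠ 0 := by
      simpa using mul_ne_zero h2 hH0
    have hrw : eulerDerivation K (G : K⸨X⸩) / (2 * H) =
        (((PowerSeries.mk fun n => (n : K) * PowerSeries.coeff n G) * (PowerSeries.C (2 : K) * H)⁻¹ :
          K⟦X⟧) : K⸨X⸩) := by
      rw [eulerDerivation_ofPowerSeries, div_eq_mul_inv, PowerSeries.coe_mul,
        ← inv_coe_eq_coe_inv _ hc, PowerSeries.coe_mul, PowerSeries.coe_C, two_eq_C]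
    rw [hrw]
    apply coeff_coe_eq_zero_of_constantCoeff _ hj
    simp
  · -- `H(0) = 0`: switch charts
    push Not at hH0
    set x₀ := PowerSeries.constantCoeff G with hx₀
    -- the equation of power series and its constant term
    have heqPS : H ^ 2 = G ^ 3 + PowerSeries.C A * G + PowerSeries.C B := by
      apply HahnSeries.ofPowerSeries_injective (Γ := ℤ) (R := K)
      simpa [PowerSeries.coe_mul, PowerSeries.coe_pow, PowerSeries.coe_add, PowerSeries.coe_C]
        using heq
    have hroot : x₀ ^ 3 + A * x₀ + B = 0 := by
      have := congrArg PowerSeries.constantCoeff heqPS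
      simp only [map_pow, map_add, map_mul, PowerSeries.constantCoeff_C] at this
      rw [hH0] at this
      rw [hx₀]
      linear_combination -this
    have h3 : 3 * x₀ ^ 2 + A ≠ 0 := fun h0 => hAB (disc_eq_zero_of_common_root hroot h0)
    -- `S = 3G² + A` is a unit
    set S : K⟦X⟧ := PowerSeries.C 3 * G ^ 2 + PowerSeries.C A with hS
    have hS0 : PowerSeries.constantCoeff S ≠ 0 := by
      simpa [hS, hx₀] using h3
    have hSne : (S : K⸨X⸩) ≠ 0 := by
      intro h0
      apply hS0
      have : S = 0 :=
        HahnSeries.ofPowerSeries_injective (Γ := ℤ) (R := K) (by rw [map_zero]; exact h0)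
      rw [this, map_zero]
    have hC2 : (2 : K⸨X⸩) ≠ 0 := by rw [two_eq_C]; exact HahnSeries.C_ne_zero h2
    have h2H : (2 : K⸨X⸩) * H ≠ 0 := mul_ne_zero hC2 hH
    -- `2H θH = (3G² + A) θG`
    have hid : (2 : K⸨X⸩) * H * eulerDerivation K (H : K⸨X⸩) =
        (S : K⸨X⸩) * eulerDerivation K (G : K⸨X⸩) := by
      have := congrArg (eulerDerivation K) heq
      have hA : eulerDerivation K (HahnSeries.C A : K⸨X⸩) = 0 := by
        rw [← algebraMap_laurent_eq_C, Derivation.map_algebraMap]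
      have hB : eulerDerivation K (HahnSeries.C B : K⸨X⸩) = 0 := by
        rw [← algebraMap_laurent_eq_C, Derivation.map_algebraMap]
      simp only [map_add, Derivation.leibniz, Derivation.leibniz_pow, hA, hB, smul_eq_mul,
        nsmul_eq_mul, add_zero] at this
      push_cast at this
      rw [hS, PowerSeries.coe_add, PowerSeries.coe_mul, PowerSeries.coe_C, PowerSeries.coe_pow,
        PowerSeries.coe_C]
      rw [three_eq_C] at this
      linear_combination this
    have hrw : eulerDerivation K (G : K⸨X⸩) / (2 * H) =
        eulerDerivation K (H : K⸨X⸩) / (S : K⸨X⸩) := by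
      rw [div_eq_div_iff h2H hSne]
      linear_combination -hid
    have hrw' : eulerDerivation K (H : K⸨X⸩) / (S : K⸨X⸩) =
        (((PowerSeries.mk fun n => (n : K) * PowerSeries.coeff n H) * S⁻¹ : K⟦X⟧) : K⸨X⸩) := by
      rw [eulerDerivation_ofPowerSeries, div_eq_mul_inv, PowerSeries.coe_mul,
        ← inv_coe_eq_coe_inv _ hS0]
    rw [hrw, hrw']
    apply coeff_coe_eq_zero_of_constantCoeff _ hj
    simp

/-- **Invariant differentials vanish at `t = 0` along `t·d/dt`.** Let `4A³ + 27B² ≠ 0` and let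
`(g, h)` be a point of `y² = x³ + Ax + B` over the Laurent series field `K⸨t⸩` with `h ≠ 0`.
Then `θg/(2h)`, `θ = t·d/dt`, has no coefficients in degrees `≤ 0` (it vanishes at `t = 0`):
poles of `g` of order `2m` give a zero of order `m`, and at regular points `θ` itself produces the
zero. This is the local computation showing that the pull-back of the invariant differential
`dx/(2y)` along a `K(t)`-point is a differential without pole at `t = 0`, paired with the vector
field `t·d/dt` which vanishes there. [folklore] -/
theorem coeff_eulerDerivation_div_eq_zero [CharZero K] {A B : K} (hAB : 4 * A ^ 3 + 27 * B ^ 2 ≠ 0)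
    {g h : K⸨X⸩} (hh : h ≠ 0) (heq : h ^ 2 = g ^ 3 + HahnSeries.C A * g + HahnSeries.C B)
    {j : ℤ} (hj : j ≤ 0) : (eulerDerivation K g / (2 * h)).coeff j = 0 := by
  rcases lt_or_ge g.order 0 with hn | hn
  · exact coeff_eulerDerivation_div_of_order_neg A B hh heq hn hj
  · obtain ⟨G, rfl⟩ := exists_powerSeries_of_order_nonneg hn
    have heq' : h ^ 2 = ((G ^ 3 + PowerSeries.C A * G + PowerSeries.C B : K⟦X⟧) : K⸨X⸩) := by
      rw [heq]
      simp [PowerSeries.coe_mul, PowerSeries.coe_pow, PowerSeries.coe_add]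
    obtain ⟨H, rfl⟩ := exists_powerSeries_of_sq_eq_coe heq'
    exact coeff_eulerDerivation_div_coe hAB hh heq hj

end AxSchanuelWeierstrass

end Literature.NumberTheory.Transcendental
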